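import Summits.AtomisticToContinuum.HydrodynamicLimit.Theorems.AnnealedZeroHorizonMeanFluxClosureDeviatoricStressClosure
import HarnessLib

/-!
# Crux `MeanFluxClosure` (stmt-AtomisticToContinuum-9256), line `registered` — stub KE-b
# (ideal energy-current / heat-flux closure), part 1: the exact enthalpy/heat-flux identity

Support file (`--supports stmt-AtomisticToContinuum-9256`) for the stub
`stub_idealEnergyCurrentClosure` (KE-b) of the lead's skeleton of
`Summit.AtomisticToContinuum.HydrodynamicLimit.Theses.AnnealedZeroHorizon.MeanFluxClosure`.
The stub asserts `E[T^e_ψ − J^e_ψ] → 0` where, along the hard-sphere flow and for a probability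
kernel `k ≥ 0`, `T^e_ψ = ∫∫ (N+1)⁻¹Σ_a k(x−x_a) (v_a·∇ψ(x)) ‖v_a‖²/2 dx ds` (the mollified kinetic
ENERGY CURRENT tested with `∇ψ`) and `J^e_ψ = ∫∫ ((En + RΘ)/R) (Mv·∇ψ) dx ds` (the IDEAL enthalpy
flux of the mollified empirical density/momentum/energy `R, Mv, En`,
`Θ = ⅔(En/R − ‖Mv‖²/(2R²))`, real division, junk `0` at `R = 0`). For a general configuration
`w : Config n (Fin 3) 𝕋³`, point `x` and kernel `k ≥ 0` (incl. the degenerate case `R = 0`), with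
`u = Mv/R`, `c_a = v_a − u`, the scale-`ℓ` peculiar stress
`P_ij = n⁻¹Σ_a k(x−x_a)(c_a)_i(c_a)_j` (`tr P = 3RΘ`), its deviator `Dev = P − (tr P/3)𝟙` and the
scale-`ℓ` HEAT FLUX `q_i = n⁻¹Σ_a k(x−x_a)(c_a)_i ‖c_a‖²/2`:

* `energyCurrent_sub_idealEnergyCurrent_eq` — the EXACT identity
  `n⁻¹Σ_a k(x−x_a)(v_a·∇ψ)‖v_a‖²/2 − ((En + RΘ)/R)(Mv·∇ψ) = Σ_i (Σ_j Dev_ij u_j + q_i) ∂_iψ`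
  (`n⁻¹Σ_a k_a v_a‖v_a‖²/2 = (En + RΘ)u + Dev u + q` since `Σ_a k_a c_a = 0`), written over an
  abstract weight vector `κ ≥ 0` and velocities `v`, and specialised to configurations with the
  stub's mollified fields written out (registered sub-goal `stub_idealEnergyCurrentClosure_identity`):
  the stub's integrand IS `(Dev u + q)·∇ψ` — the general stub is the vanishing IN MEAN of the
  scale-`ℓ` heat flux plus the velocity-weighted isotropy of the peculiar stress along the
  deterministic dynamics;
* `avg_mul_sub_mul_sumSq_sub_eq` — the moment expansion of the heat flux around an arbitrary
  reference velocity.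

Parts 2–3 (`…B.lean`, `…C.lean`): integrability at every `N`; mean zero at equilibrium.
No definitions. References: Spohn, *Large Scale Dynamics of Interacting Particles* (1991), Part I Ch. 3.
-/

noncomputable section

namespace Summit.AtomisticToContinuum.HydrodynamicLimit.Theorems

open scoped BigOperators ENNReal Topology InnerProductSpace
open MeasureTheory Set Filter
open Literature.Analysis.FluidPDE Literature.Analysis.FunctionSpaces
open Literature.MathematicalPhysics.KineticTheory

namespace IdealEnergyCurrentClosure

open DeviatoricStressClosure

/-! ### The exact scale-`ℓ` enthalpy/heat-flux identity (pure algebra) -/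

/-- Expansion of the scale-`ℓ` heat flux around an arbitrary reference velocity `p`:
`c Σ_a κ_a (v_a^i − p_i) Σ_l (v_a^l − p_l)²/2` in terms of the weighted moments
`c Σ κ`, `c Σ κ v^l`, `c Σ κ v^i v^l`, `c Σ κ ‖v‖²/2`, `c Σ κ v^i ‖v‖²`. [folklore] -/
theorem avg_mul_sub_mul_sumSq_sub_eq {n : ℕ} (κ : Fin n → ℝ) (v : Fin n → V3) (c : ℝ)
    (p : Fin 3 → ℝ) (i : Fin 3) :
    c * ∑ a, κ a * ((v a i - p i) * ((∑ l, (v a l - p l) ^ 2) / 2)) =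
      (c * ∑ a, κ a * (v a i * ‖v a‖ ^ 2)) / 2 -
        (∑ l, p l * (c * ∑ a, κ a * (v a i * v a l))) +
        (∑ l, p l ^ 2) / 2 * (c * ∑ a, κ a * v a i) -
        p i * (c * ∑ a, κ a * (‖v a‖ ^ 2 / 2)) +
        p i * (∑ l, p l * (c * ∑ a, κ a * v a l)) -
        p i * ((∑ l, p l ^ 2) / 2) * (c * ∑ a, κ a) := by
  simp only [Fin.sum_univ_three]
  have h : ∀ a, κ a * ((v a i - p i) * (((v a 0 - p 0) ^ 2 + (v a 1 - p 1) ^ 2 +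
      (v a 2 - p 2) ^ 2) / 2)) =
      κ a * (v a i * ‖v a‖ ^ 2) / 2 -
        (p 0 * (κ a * (v a i * v a 0)) + p 1 * (κ a * (v a i * v a 1)) +
          p 2 * (κ a * (v a i * v a 2))) +
        (p 0 ^ 2 + p 1 ^ 2 + p 2 ^ 2) / 2 * (κ a * v a i) -
        p i * (κ a * (‖v a‖ ^ 2 / 2)) +
        p i * (p 0 * (κ a * v a 0) + p 1 * (κ a * v a 1) + p 2 * (κ a * v a 2)) -
        p i * ((p 0 ^ 2 + p 1 ^ 2 + p 2 ^ 2) / 2) * κ a := fun a => by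
    rw [EuclideanSpace.real_norm_sq_eq (v a), Fin.sum_univ_three]
    ring
  simp_rw [h]
  simp only [Finset.sum_sub_distrib, Finset.sum_add_distrib, mul_add]
  simp only [← Finset.mul_sum, ← Finset.sum_div]
  ring

/-- Swapping the finite sums in the mollified energy current tested with a covector `ψ'`:
`c Σ_a κ_a (Σ_i v_a^i ψ'_i) ‖v_a‖²/2 = Σ_i (c Σ_a κ_a v_a^i ‖v_a‖²)/2 · ψ'_i`. [folklore] -/
theorem avg_current_eq_sum {n : ℕ} (κ : Fin n → ℝ) (v : Fin n → V3) (c : ℝ) (ψ' : Fin 3 → ℝ) :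
    c * ∑ a, κ a * ((∑ i, v a i * ψ' i) * (‖v a‖ ^ 2 / 2)) =
      ∑ i, (c * ∑ a, κ a * (v a i * ‖v a‖ ^ 2)) / 2 * ψ' i := by
  simp only [Finset.mul_sum, Finset.sum_mul, Finset.sum_div]
  rw [Finset.sum_comm]
  exact Finset.sum_congr rfl fun i _ => Finset.sum_congr rfl fun a _ => by ring

/-- **The exact scale-`ℓ` enthalpy/heat-flux identity** over abstract weights `κ ≥ 0` and
velocities `v` (constant `c`, covector `ψ'`): with `R = cΣκ`, `Mv_l = cΣκv^l`, `En = cΣκ‖v‖²/2`,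
`Θ = ⅔(En/R − ‖Mv‖²/(2R²))`, `u = Mv/R`, `P_ij = cΣ_a κ_a(v_a^i − u_i)(v_a^j − u_j)`,
`q_i = cΣ_a κ_a (v_a^i − u_i) Σ_l (v_a^l − u_l)²/2` (real division, junk `0` at `R = 0` where all
weights vanish):
`cΣ_a κ_a (v_a·ψ') ‖v_a‖²/2 − ((En + RΘ)/R)(Mv·ψ') = Σ_i (Σ_j (P_ij − δ_ij tr P/3) u_j + q_i) ψ'_i`.
[folklore] -/
theorem energyCurrent_sub_idealEnergyCurrent_eq {n : ℕ} (κ : Fin n → ℝ) (hκ : ∀ a, 0 ≤ κ a)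
    (v : Fin n → V3) (c : ℝ) (ψ' : Fin 3 → ℝ) {R En : ℝ} {Mv : V3}
    (hR : R = c * ∑ a, κ a) (hMv : ∀ l, Mv l = c * ∑ a, κ a * v a l)
    (hEn : En = c * ∑ a, κ a * (‖v a‖ ^ 2 / 2)) :
    c * ∑ a, κ a * ((∑ i, v a i * ψ' i) * (‖v a‖ ^ 2 / 2)) -
        (En + R * (2 / 3 * (En / R - ‖Mv‖ ^ 2 / (2 * R ^ 2)))) / R * (∑ i, Mv i * ψ' i) =
      ∑ i, ((∑ j, (c * ∑ a, κ a * ((v a i - Mv i / R) * (v a j - Mv j / R)) -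
          (if i = j then 1 else 0) *
            ((∑ l, c * ∑ a, κ a * ((v a l - Mv l / R) * (v a l - Mv l / R))) / 3)) *
            (Mv j / R)) +
        c * ∑ a, κ a * ((v a i - Mv i / R) * ((∑ l, (v a l - Mv l / R) ^ 2) / 2))) * ψ' i := by
  rcases eq_or_ne R 0 with hR0 | hR0
  · -- degenerate case: all weights vanish (or `c = 0`)
    have hck : ∀ a, c * κ a = 0 := by
      intro a
      rcases mul_eq_zero.1 (hR.symm.trans hR0) with h0 | h0
      · rw [h0, zero_mul]
      · rw [(Finset.sum_eq_zero_iff_of_nonneg fun b _ => hκ b).1 h0 a (Finset.mem_univ a), mul_zero]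
    have hvan : ∀ f : Fin n → ℝ, c * ∑ a, κ a * f a = 0 := fun f => by
      rw [Finset.mul_sum]
      exact Finset.sum_eq_zero fun a _ => by rw [← mul_assoc, hck a, zero_mul]
    have hMv0 : ∀ l, Mv l = 0 := fun l => by rw [hMv, hvan]
    simp only [hMv0, hvan, zero_mul, mul_zero, sub_zero, zero_div, Finset.sum_const_zero, add_zero]
  · -- generic case: moments
    have hP : ∀ i j, c * ∑ a, κ a * ((v a i - Mv i / R) * (v a j - Mv j / R)) =
        c * ∑ a, κ a * (v a i * v a j) - Mv i * Mv j / R := by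
      intro i j
      rw [avg_mul_sub_mul_sub_eq, ← hMv i, ← hMv j, ← hR]
      field_simp
      ring
    have htr : ∑ l, c * ∑ a, κ a * ((v a l - Mv l / R) * (v a l - Mv l / R)) =
        2 * En - ‖Mv‖ ^ 2 / R := by
      simp_rw [hP]
      rw [Finset.sum_sub_distrib, sum_avg_mul_self_eq, ← hEn, EuclideanSpace.real_norm_sq_eq,
        Finset.sum_div]
      simp only [sq, mul_div_assoc]
    have hq : ∀ i, c * ∑ a, κ a * ((v a i - Mv i / R) * ((∑ l, (v a l - Mv l / R) ^ 2) / 2)) =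
        (c * ∑ a, κ a * (v a i * ‖v a‖ ^ 2)) / 2 -
          (Mv 0 * (c * ∑ a, κ a * (v a i * v a 0)) + Mv 1 * (c * ∑ a, κ a * (v a i * v a 1)) +
            Mv 2 * (c * ∑ a, κ a * (v a i * v a 2))) / R -
          Mv i * En / R + Mv i * ‖Mv‖ ^ 2 / R ^ 2 := by
      intro i
      have h := avg_mul_sub_mul_sumSq_sub_eq κ v c (fun l => Mv l / R) i
      simp only [Fin.sum_univ_three] at h ⊢
      rw [h, ← hMv 0, ← hMv 1, ← hMv 2, ← hMv i, ← hR, ← hEn, EuclideanSpace.real_norm_sq_eq Mv,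
        Fin.sum_univ_three]
      field_simp
      ring
    rw [avg_current_eq_sum, Finset.mul_sum, ← Finset.sum_sub_distrib]
    refine Finset.sum_congr rfl fun i _ => ?_
    rw [htr, hq i]
    simp_rw [hP]
    simp only [sub_mul, Finset.sum_sub_distrib, ite_mul, one_mul, zero_mul, Finset.sum_ite_eq,
      Finset.mem_univ, if_true, EuclideanSpace.real_norm_sq_eq Mv, Fin.sum_univ_three]
    field_simp
    ring

end IdealEnergyCurrentClosure

open IdealEnergyCurrentClosure DeviatoricStressClosure in
/-- **Registered sub-goal `stub_idealEnergyCurrentClosure_identity` of stub KE-b: the stub's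
integrand IS the deviatoric-stress work plus the scale-`ℓ` heat flux, tested with `∇ψ`.** For every
configuration `w`, base point `x`, kernel `k ≥ 0` and scalar test function `ψ`, the T^e-integrand
minus the J^e-integrand of `stub_idealEnergyCurrentClosure` (mollified kinetic energy current tested
with `∇ψ` minus the ideal enthalpy flux `((En + RΘ)/R)(Mv·∇ψ)` of the mollified fields `R, Mv, En`,
`Θ = ⅔(En/R − ‖Mv‖²/(2R²))`, all written out) equals `Σ_i (Σ_j (P_ij − δ_ij tr P/3) Mv_j/R + q_i) ∂_iψ(x)`
with the scale-`ℓ` peculiar stress `P_ij = n⁻¹Σ_a k(x−x_a)(v_a^i − Mv_i/R)(v_a^j − Mv_j/R)` and the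
scale-`ℓ` heat flux `q_i = n⁻¹Σ_a k(x−x_a)(v_a^i − Mv_i/R) Σ_l (v_a^l − Mv_l/R)²/2`, in all cases
including `R = 0` (`energyCurrent_sub_idealEnergyCurrent_eq`). Hence the general stub KE-b is EXACTLY
the statement that `E ∫∫ (Dev u + q)·∇ψ dx ds → 0`: zero scale-`ℓ` heat flux and velocity-weighted
isotropy of the peculiar stress IN MEAN along the deterministic dynamics. [folklore] -/
theorem stub_idealEnergyCurrentClosure_identity : ∀ (n : ℕ) (w : Literature.Analysis.FluidPDE.Config n (Fin 3) Literature.MathematicalPhysics.KineticTheory.T3) (x : Literature.MathematicalPhysics.KineticTheory.T3) (k : Literature.MathematicalPhysics.KineticTheory.T3 → ℝ), (∀ y, 0 ≤ k y) → ∀ (ψ : Literature.MathematicalPhysics.KineticTheory.T3 → ℝ), (n : ℝ)⁻¹ * ∑ a, k (x - (w a).1) * ((∑ i, (w a).2 i * Literature.Analysis.FunctionSpaces.Torus.partialDeriv i ψ x) * (‖(w a).2‖ ^ 2 / 2)) - (((Literature.MathematicalPhysics.KineticTheory.empiricalEnergyField w (fun y => k (x - y)) + Literature.MathematicalPhysics.KineticTheory.empiricalDensityField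 w (fun y => k (x - y)) * (2 / 3 * (Literature.MathematicalPhysics.KineticTheory.empiricalEnergyField w (fun y => k (x - y)) / Literature.MathematicalPhysics.KineticTheory.empiricalDensityField w (fun y => k (x - y)) - ‖Literature.MathematicalPhysics.KineticTheory.empiricalMomentumField w (fun y => k (x - y))‖ ^ 2 / (2 * Literature.MathematicalPhysics.KineticTheory.empiricalDensityField w (fun y => k (x - y)) ^ 2)))) / Literature.MathematicalPhysics.KineticTheory.empiricalDensityField w (fun y => k (x - y))) * (∑ i, Literature.MathematicalPhysics.KineticTheory.empiricalMomentumField w (fun y => k (x - y)) i * Literature.Analysis.FunctionSpaces.Torus.partialDeriv i ψ x)) = ∑ i, ((∑ j, ((n : ℝ)⁻¹ * ∑ a, k (x - (w a).1) * (((w a).2 i - Literature.MathematicalPhysics.KineticTheory.empiricalMomentumField w (fun y => k (x - y)) i / Literature.MathematicalPhysics.KineticTheory.empiricalDensityField w (fun y => k (x - y))) * ((w a).2 j - Literature.MathematicalPhysics.KineticTheory.empiricalMomentumField w (fun y => k (x - y)) j / Literature.MathematicalPhysics.KineticTheory.empiricalDensityField w (fun y => k (x - y)))) - (if i = j then 1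 else 0) * ((∑ l, (n : ℝ)⁻¹ * ∑ a, k (x - (w a).1) * (((w a).2 l - Literature.MathematicalPhysics.KineticTheory.empiricalMomentumField w (fun y => k (x - y)) l / Literature.MathematicalPhysics.KineticTheory.empiricalDensityField w (fun y => k (x - y))) * ((w a).2 l - Literature.MathematicalPhysics.KineticTheory.empiricalMomentumField w (fun y => k (x - y)) l / Literature.MathematicalPhysics.KineticTheory.empiricalDensityField w (fun y => k (x - y))))) / 3)) * (Literature.MathematicalPhysics.KineticTheory.empiricalMomentumField w (fun y => k (x - y)) j / Literature.MathematicalPhysics.KineticTheory.empiricalDensityField w (fun y => k (x - y)))) + (n : ℝ)⁻¹ * ∑ a, k (x - (w a).1) * (((w a).2 i - Literature.MathematicalPhysics.KineticTheory.empiricalMomentumField w (fun y => k (x - y)) i / Literature.MathematicalPhysics.KineticTheory.empiricalDensityField w (fun y => k (x - y))) * ((∑ l, ((w a).2 l - Literature.MathematicalPhysics.KineticTheory.empiricalMomentumField w (fun y => k (x - y)) l / Literature.MathematicalPhysics.KineticTheory.empiricalDensityField w (fun y => k (x - y))) ^ 2) / 2))) * Literature.Analysis.FunctionSpaces.Torus.partialDeriv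 i ψ x := by
  intro n w x k hk0 ψ
  exact energyCurrent_sub_idealEnergyCurrent_eq (fun a => k (x - (w a).1)) (fun a => hk0 _)
    (fun a => (w a).2) _ (fun i => Torus.partialDeriv i ψ x) (empiricalDensityField_eq_sum _ _)
    (fun l => empiricalMomentumField_apply _ _ l) (empiricalEnergyField_eq_sum _ _)

end Summit.AtomisticToContinuum.HydrodynamicLimit.Theorems

end
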